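import Summits.ABC.StewartYu.ArchShapeChainProof
import Summits.ABC.StewartYu.PadicShapeChainProof
import HarnessLib

/-!
# Cell abc-stewartyu — draft route `YuMatveevShapeRat` (plan-m3 g2, HOME/plan-m3/next/SketchGA.lean):
# `HalvesJoin` and the assembly — the library rung "A1.L" over `ℚ` from the three SHAPE cores, PROVED

Cell `abc-stewartyu` (HOME `run/shared/lean/pub/abc-stewartyu/`; seat `lit-abc-yu2007` g3). Theorems only;
no definition, no named fact, nothing closed (the route is a draft, not opened; its target
`Dioph.approximationBound_rat := ∃ K, 1 ≤ K ∧ PastenApproximationBound K` is a definition REQUEST, so the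
conclusion below is that text unfolded). `approximationBound_of_shapeCores`: the planner's texts of the three
cruxes `ArchCoreRat`, `PadicCoreOddRat`, `PadicCoreTwoRat` (verbatim) imply
`∃ K ≥ 1, Dioph.PastenApproximationBound K` — Pasten 2024 Thm. 2.1 (`d = 1`) / Evertse–Győry Thm. 4.2.1 over
`ℚ` at `α = 1` with the constant existential, the statement all `…_of_approximationBound` consumers of the
tree are parametric in. Assembly of `archHalf_of_archCoreRat` (`ArchShapeChain`) and
`padicHalf_of_padicCores` (`PadicShapeChain`) with `K = max K_∞ K_p` (`halvesJoin`). So, of the draft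
route, exactly the three cruxes remain: an archimedean and two `p`-adic Kummer-free Gen-3 engines over `ℚ`
with constant `cⁿ` (XL; NOT proved here). WHAT THIS IS NOT: no engine; no abc claim; nothing closed.
References: [Pasten2024] Thm. 2.1; [EvertseGyory2015] Thm. 4.2.1, §4.4.
-/

open Height Real Finset
open Literature.NumberTheory.DiophantineGeometry.Dioph

noncomputable section

namespace Summit.ABC.StewartYu

/-- **`HalvesJoin`**: the archimedean half and the `p`-adic half (texts of `ArchHalf`, `PadicHalf`) give
`∃ K ≥ 1, PastenApproximationBound K` (`K = max K_∞ K_p`). [cite: Pasten2024, Theorem 2.1] -/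
theorem halvesJoin
    (hA : ∃ K : ℝ, 1 ≤ K ∧ ∀ (ι : Type) [Fintype ι], 0 < Fintype.card ι → ∀ ξ : ι → ℚ,
      (∀ i, ξ i ≠ 0 ∧ ξ i ≠ 1 ∧ ξ i ≠ -1) → ∀ ζ : ℚ, (ζ = 1 ∨ ζ = -1) → ∀ b : ι → ℤ,
      ζ * ∏ i, ξ i ^ b i ≠ 1 →
        -(K ^ Fintype.card ι * Real.log (max (Real.exp 1) (Height.logHeight₁ (ζ * ∏ i, ξ i ^ b i))) *
            ∏ i, Height.logHeight₁ (ξ i)) <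
          Real.log |1 - ((ζ * ∏ i, ξ i ^ b i : ℚ) : ℝ)|)
    (hP : ∃ K : ℝ, 1 ≤ K ∧ ∀ (ι : Type) [Fintype ι], 0 < Fintype.card ι → ∀ ξ : ι → ℚ,
      (∀ i, ξ i ≠ 0 ∧ ξ i ≠ 1 ∧ ξ i ≠ -1) → ∀ ζ : ℚ, (ζ = 1 ∨ ζ = -1) → ∀ b : ι → ℤ,
      ζ * ∏ i, ξ i ^ b i ≠ 1 → ∀ p : ℕ, p.Prime →
        (padicValRat p (1 - ζ * ∏ i, ξ i ^ b i) : ℝ) * Real.log p <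
          K ^ Fintype.card ι * (p / Real.log p) *
            Real.log (max (Real.exp 1) (p * Height.logHeight₁ (ζ * ∏ i, ξ i ^ b i))) *
            ∏ i, Height.logHeight₁ (ξ i)) :
    ∃ K : ℝ, 1 ≤ K ∧ PastenApproximationBound K := by
  obtain ⟨K₁, hK₁, hA⟩ := hA
  obtain ⟨K₂, hK₂, hP⟩ := hP
  refine ⟨max K₁ K₂, le_trans hK₁ (le_max_left _ _), ?_⟩
  intro ι _ hι ξ hξ ζ hζ b hΞ
  have hΘ0 : 0 ≤ ∏ i, logHeight₁ (ξ i) := Finset.prod_nonneg fun i _ => Height.zero_le_logHeight₁ _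
  have hpow₁ : K₁ ^ Fintype.card ι ≤ (max K₁ K₂) ^ Fintype.card ι :=
    pow_le_pow_left₀ (by linarith) (le_max_left _ _) _
  have hpow₂ : K₂ ^ Fintype.card ι ≤ (max K₁ K₂) ^ Fintype.card ι :=
    pow_le_pow_left₀ (by linarith) (le_max_right _ _) _
  refine ⟨?_, fun p hp => ?_⟩
  · have h := hA ι hι ξ hξ ζ hζ b hΞ
    have hY0 : 0 ≤ Real.log (max (Real.exp 1) (logHeight₁ (ζ * ∏ i, ξ i ^ b i))) := by
      rw [← Real.log_exp 0]
      exact Real.log_le_log (Real.exp_pos 0) (le_trans (Real.exp_le_exp.mpr zero_le_one) (le_max_left _ _))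
    have h1 := mul_le_mul_of_nonneg_right (mul_le_mul_of_nonneg_right hpow₁ hY0) hΘ0
    push_cast at h ⊢
    linarith
  · have h := hP ι hι ξ hξ ζ hζ b hΞ p hp
    have hp1 : (1 : ℝ) < p := by exact_mod_cast hp.one_lt
    have hq0 : 0 ≤ (p : ℝ) / Real.log p := div_nonneg (by linarith) (Real.log_pos hp1).le
    have hY0 : 0 ≤ Real.log (max (Real.exp 1) ((p : ℝ) * logHeight₁ (ζ * ∏ i, ξ i ^ b i))) := by
      rw [← Real.log_exp 0]
      exact Real.log_le_log (Real.exp_pos 0) (le_trans (Real.exp_le_exp.mpr zero_le_one) (le_max_left _ _))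
    have h1 := mul_le_mul_of_nonneg_right (mul_le_mul_of_nonneg_right
      (mul_le_mul_of_nonneg_right hpow₂ hq0) hY0) hΘ0
    linarith

/-- **The library rung "A1.L" over `ℚ` from the three SHAPE cores** (the draft route's deciding chain
`closes := hJ (hA h₁) (hP h₂ h₃)` with every support PROVED): the planner's texts of `ArchCoreRat`,
`PadicCoreOddRat`, `PadicCoreTwoRat` imply `∃ K ≥ 1, PastenApproximationBound K`.
[cite: Pasten2024, Theorem 2.1] [cite: EvertseGyory2015, Thm 4.2.1 (§4.4)] -/
theorem approximationBound_of_shapeCores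
    (h₁ : ∃ c : ℝ, ∀ (r : ℕ) (a : Fin r → ℚ) (b : Fin r → ℤ) (A : Fin r → ℝ) (B : ℝ),
      (∀ i, 0 < a i) →
      (∀ μ : Fin r → ℤ, ∏ i, a i ^ μ i = 1 → μ = 0) →
      (∀ i, Height.logHeight₁ (a i) ≤ A i) → (∀ i, 1 ≤ A i) →
      b ≠ 0 → (∀ i, (|b i| : ℝ) ≤ B) →
      -(c ^ r * (∏ i, A i) * Real.log (Real.exp 1 * B)) ≤
        Real.log |∑ i, (b i : ℝ) * Real.log (a i : ℝ)|)
    (h₂ : ∃ c : ℝ, ∀ (p : ℕ), p.Prime → p ≠ 2 →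
      ∀ (r : ℕ) (θ : Fin r → ℚ) (m : Fin r → ℤ) (A : Fin r → ℝ) (Amax W : ℝ),
        (∀ i, θ i ≠ 0 ∧ padicValRat p (θ i) = 0) →
        (∀ μ : Fin r → ℤ, ∏ i, θ i ^ μ i = 1 → μ = 0) →
        (∀ i, Height.logHeight₁ (θ i) ≤ A i) → (∀ i, 1 ≤ A i) → (∀ i, A i ≤ Amax) →
        m ≠ 0 → (∀ i, Real.log (max 3 (|m i| : ℝ)) ≤ W) → 1 ≤ W →
        (padicValRat p (∏ i, θ i ^ m i - 1) : ℝ) * Real.log p ≤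
          c ^ r * ((p : ℝ) / Real.log p) * (∏ i, A i) * (W + Real.log p + Real.log (2 * Amax)))
    (h₃ : ∃ c : ℝ, ∀ (r : ℕ) (θ : Fin r → ℚ) (m : Fin r → ℤ) (A : Fin r → ℝ) (Amax W : ℝ),
      (∀ i, 3 ≤ padicValRat 2 (θ i - 1)) →
      (∀ μ : Fin r → ℤ, ∏ i, θ i ^ μ i = 1 → μ = 0) →
      (∀ i, Height.logHeight₁ (θ i) ≤ A i) → (∀ i, 1 ≤ A i) → (∀ i, A i ≤ Amax) →
      m ≠ 0 → (∀ i, Real.log (max 3 (|m i| : ℝ)) ≤ W) → 1 ≤ W →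
      (padicValRat 2 (∏ i, θ i ^ m i - 1) : ℝ) ≤ c ^ r * (∏ i, A i) * (W + Real.log (2 * Amax))) :
    ∃ K : ℝ, 1 ≤ K ∧ PastenApproximationBound K :=
  halvesJoin (archHalf_of_archCoreRat h₁) (padicHalf_of_padicCores h₂ h₃)

end Summit.ABC.StewartYu

end
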